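import Literature.Combinatorics.SimpleGraph.CycleSpaceSeparators
import HarnessLib

/-!
# Lemma B.83 relative to a vertex set (Timár's lemma for induced subgraphs)

Topic `Literature/Combinatorics/SimpleGraph`. Companion of `CycleSpaceSeparators.lean`, whose
`exists_generator_crossing_both` (Friedli–Velenik 2017, App. B.15, Lemma B.83, after Á. Timár,
Proc. AMS 141 (2013), Lemma 1 / proof of Thm. 2) is stated for a vertex set `A` whose complement IN THE
WHOLE VERTEX TYPE is connected. Here the same statement and the same proof are given RELATIVE TO A
VERTEX SET `V ⊇ A`: the complement is `V ∖ A`, walks outside `A` are only required between vertices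
of `V` and may be taken inside `V`, the crossing edges are the edges of `G` inside `V` with exactly
one endpoint in `A`, and the generating family only has to generate the even edge sets of `G` INSIDE
`V`. This is Lemma B.83 for the subgraph of `G` induced on `V`, without forming the induced subgraph
as a graph on a subtype — the form used for `★`-boundaries inside a box of `ℤ^d`
(`Literature/Probability/LatticeModels/StarBoundaryBox.lean`), where `V` is the box and the generators
are the `★`-triangles with vertices in the box.

* `exists_generator_crossing_both_rel` — if `A ⊆ V`, `A` is connected, `V ∖ A` is connected inside
  `V`, and `𝒞` generates every even set of `G`-edges inside `V`, then every 2-partition of the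
  `G`-edges inside `V` crossing `A` is met on both sides by some generator.

Everything is proved; no named facts. The absolute lemma is the case `V = univ`.

## References

* S. Friedli, Y. Velenik, *Statistical Mechanics of Lattice Systems*, CUP 2017, App. B.15,
  Lemma B.83. [FriedliVelenik2017]
* Á. Timár, *Boundary-connectivity via graph theory*, Proc. Amer. Math. Soc. 141 (2013) 475–480,
  arXiv:0711.1713: Lemma 1, Theorem 3 (the statement for arbitrary graphs). [Timar2013]
-/

open Finset SimpleGraph

namespace Literature.Combinatorics.SimpleGraph.CycleSpace

variable {α : Type*} [DecidableEq α] {G : SimpleGraph α}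

omit [DecidableEq α] in
/-- The endpoints of an edge of a walk lie on the walk. [folklore] -/
private theorem mem_support_of_endpoint_of_mem_edges {u v : α} (p : G.Walk u v) {e : Sym2 α} (he : e ∈ p.edges)
    {x : α} (hx : x ∈ e) : x ∈ p.support := by
  induction e using Sym2.ind with
  | h a b =>
    rcases Sym2.mem_iff.1 hx with rfl | rfl
    · exact p.fst_mem_support_of_mem_edges he
    · exact p.snd_mem_support_of_mem_edges he

/-- **Lemma B.83 relative to a vertex set** (Friedli–Velenik 2017 / Timár 2013, for the subgraph
induced on `V`). Let `A ⊆ V`, let any two vertices of `A` be joined by a walk inside `A` and any two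
vertices of `V ∖ A` by a walk inside `V ∖ A`, and let `𝒞` be a family of even sets of `G`-edges
inside `V` generating (over `𝔽₂`) every even set of `G`-edges inside `V`. Then for every partition
`E₁ ⊔ E₂` of the `G`-edges inside `V` crossing `A` into two non-empty classes, some member of `𝒞`
contains an edge of `E₁` and an edge of `E₂`. Proof verbatim as for `exists_generator_crossing_both`
(`π₁ = e₁`, `π₂` = inside `A`, across `e₂`, back inside `V ∖ A`; split the generated even set
`E(π₁) ∆ E(π₂)` along "meets `E₁`"; cut parity).
[cite: FriedliVelenik2017, App. B.15, Lemma B.83; Timar2013, Lemma 1 and Theorem 3] -/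
theorem exists_generator_crossing_both_rel {𝒞 : Set (Finset (Sym2 α))} {V : Set α}
    (hgen : ∀ Z : Finset (Sym2 α), (∀ e ∈ Z, e ∈ G.edgeSet ∧ ∀ x ∈ e, x ∈ V) → IsEvenEdgeSet Z →
      InSpan 𝒞 Z)
    (h𝒞 : ∀ C ∈ 𝒞, IsEvenEdgeSet C) (h𝒞E : ∀ C ∈ 𝒞, ∀ e ∈ C, e ∈ G.edgeSet ∧ ∀ x ∈ e, x ∈ V)
    {A : Finset α} (hAV : ∀ a ∈ A, a ∈ V)
    (hA : ∀ a ∈ A, ∀ a' ∈ A, ∃ p : G.Walk a a', ∀ w ∈ p.support, w ∈ A)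
    (hAc : ∀ b ∈ V, b ∉ A → ∀ b' ∈ V, b' ∉ A → ∃ p : G.Walk b b', ∀ w ∈ p.support, w ∈ V ∧ w ∉ A)
    {E₁ E₂ : Finset (Sym2 α)}
    (hE : ∀ e, e ∈ E₁ ∨ e ∈ E₂ ↔ e ∈ G.edgeSet ∧ (∀ x ∈ e, x ∈ V) ∧ Crosses A e)
    (h₁ : E₁.Nonempty) (h₂ : E₂.Nonempty) (h₁₂ : Disjoint E₁ E₂) :
    ∃ C ∈ 𝒞, (∃ e ∈ C, e ∈ E₁) ∧ (∃ e ∈ C, e ∈ E₂) := by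
  classical
  -- orient `e₁ ∈ E₁` and `e₂ ∈ E₂` from `A` to `V ∖ A`
  have horient : ∀ e : Sym2 α, e ∈ G.edgeSet ∧ (∀ x ∈ e, x ∈ V) ∧ Crosses A e →
      ∃ u w : α, e = s(u, w) ∧ G.Adj u w ∧ u ∈ A ∧ w ∉ A ∧ w ∈ V := by
    intro e he
    induction e using Sym2.ind with
    | h x y =>
      rw [crosses_mk] at he
      rcases he.2.2 with ⟨hx, hy⟩ | ⟨hx, hy⟩
      · exact ⟨x, y, rfl, he.1, hx, hy, he.2.1 y (Sym2.mem_mk_right x y)⟩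
      · exact ⟨y, x, Sym2.eq_swap, he.1.symm, hy, hx, he.2.1 x (Sym2.mem_mk_left x y)⟩
  obtain ⟨e₁, he₁⟩ := h₁
  obtain ⟨e₂, he₂⟩ := h₂
  obtain ⟨u₁, v₁, rfl, hadj₁, hu₁, hv₁, hv₁V⟩ := horient e₁ ((hE e₁).1 (Or.inl he₁))
  obtain ⟨u₂, v₂, rfl, hadj₂, hu₂, hv₂, hv₂V⟩ := horient e₂ ((hE e₂).1 (Or.inr he₂))
  -- `π₂`: inside `A` from `u₁` to `u₂`, across `e₂`, inside `V ∖ A` from `v₂` to `v₁`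
  obtain ⟨a, ha⟩ := hA u₁ hu₁ u₂ hu₂
  obtain ⟨b, hb⟩ := hAc v₂ hv₂V hv₂ v₁ hv₁V hv₁
  set π₂ : G.Walk u₁ v₁ := a.append (Walk.cons hadj₂ b) with hπ₂
  have hπ₂E₁ : ∀ e ∈ π₂.edges, e ∉ E₁ := by
    intro e he heE₁
    rw [hπ₂, Walk.edges_append, List.mem_append, Walk.edges_cons, List.mem_cons] at he
    rcases he with he | rfl | he
    · exact not_crosses_of_support_subset a ha he ((hE e).1 (Or.inl heE₁)).2.2
    · exact Finset.disjoint_left.1 h₁₂ heE₁ he₂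
    · exact not_crosses_of_support_disjoint b (fun w hw => (hb w hw).2) he ((hE e).1 (Or.inl heE₁)).2.2
  have hπ₂V : ∀ w ∈ π₂.support, w ∈ V := by
    intro w hw
    rw [hπ₂, Walk.support_append, List.mem_append, Walk.support_cons, List.tail_cons] at hw
    rcases hw with hw | hw
    · exact hAV w (ha w hw)
    · exact (hb w hw).1
  set q₂ : G.Walk u₁ v₁ := π₂.bypass with hq₂
  have hq₂E₁ : ∀ e ∈ walkEdges q₂, e ∉ E₁ := fun e he =>
    hπ₂E₁ e (π₂.edges_bypass_subset_edges (List.mem_toFinset.1 he))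
  have hq₂V : ∀ e ∈ walkEdges q₂, ∀ x ∈ e, x ∈ V := fun e he x hx =>
    hπ₂V x (mem_support_of_endpoint_of_mem_edges π₂ (π₂.edges_bypass_subset_edges (List.mem_toFinset.1 he)) hx)
  have huv : u₁ ≠ v₁ := hadj₁.ne
  -- `π₁ = e₁`
  set q₁ : G.Walk u₁ v₁ := Walk.cons hadj₁ Walk.nil with hq₁
  have hq₁path : q₁.IsPath := by
    rw [hq₁, Walk.cons_isPath_iff]; exact ⟨Walk.IsPath.nil, by simp [huv]⟩
  have hE₁q₁ : walkEdges q₁ = {s(u₁, v₁)} := by simp [walkEdges, hq₁]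
  have hq₂path : q₂.IsPath := π₂.bypass_isPath
  -- the even set `E(q₁) ∆ E(q₂)` is in the span; split it along "meets E₁"
  have hZeven : IsEvenEdgeSet (symmDiff (walkEdges q₁) (walkEdges q₂)) := by
    intro w
    rw [even_edgeDeg_symmDiff_iff, ← not_iff_not, Nat.not_even_iff_odd, Nat.not_even_iff_odd,
      odd_edgeDeg_walkEdges_iff hq₁path huv, odd_edgeDeg_walkEdges_iff hq₂path huv]
  have hZedges : ∀ e ∈ symmDiff (walkEdges q₁) (walkEdges q₂), e ∈ G.edgeSet ∧ ∀ x ∈ e, x ∈ V := by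
    intro e he
    rw [mem_symmDiff] at he
    rcases he with ⟨h, -⟩ | ⟨h, -⟩
    · rw [hE₁q₁, Finset.mem_singleton] at h
      subst h
      refine ⟨(mem_edgeSet G).2 hadj₁, fun x hx => ?_⟩
      rcases Sym2.mem_iff.1 hx with rfl | rfl
      · exact hAV _ hu₁
      · exact hv₁V
    · exact ⟨mem_edgeSet_of_mem_walkEdges q₂ h, hq₂V e h⟩
  obtain ⟨Za, Zb, hZa, hZb, hZeq⟩ := (hgen _ hZedges hZeven).split (fun C => ∃ e ∈ C, e ∈ E₁)
  by_contra hcon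
  push Not at hcon
  -- `F := E(q₂) ∆ Zb` avoids `E₁`
  set F := symmDiff (walkEdges q₂) Zb with hF
  have hZbE₁ : ∀ e ∈ Zb, e ∉ E₁ := by
    intro e he heE₁
    obtain ⟨C, ⟨_, hP⟩, heC⟩ := hZb.exists_mem he
    exact hP ⟨e, heC, heE₁⟩
  have hFE₁ : ∀ e ∈ F, e ∉ E₁ := by
    intro e he
    rw [hF, mem_symmDiff] at he
    rcases he with ⟨h, -⟩ | ⟨h, -⟩
    · exact hq₂E₁ e h
    · exact hZbE₁ e h
  have hZbE : ∀ e ∈ Zb, e ∈ G.edgeSet ∧ ∀ x ∈ e, x ∈ V := fun e he => by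
    obtain ⟨C, ⟨hC, -⟩, heC⟩ := hZb.exists_mem he; exact h𝒞E C hC e heC
  have hFdiag : ∀ e ∈ F, ¬e.IsDiag := by
    intro e he
    rw [hF, mem_symmDiff] at he
    rcases he with ⟨h, -⟩ | ⟨h, -⟩
    · exact G.not_isDiag_of_mem_edgeSet (mem_edgeSet_of_mem_walkEdges q₂ h)
    · exact G.not_isDiag_of_mem_edgeSet (hZbE e h).1
  have hFV : ∀ e ∈ F, ∀ x ∈ e, x ∈ V := by
    intro e he
    rw [hF, mem_symmDiff] at he
    rcases he with ⟨h, -⟩ | ⟨h, -⟩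
    · exact hq₂V e h
    · exact (hZbE e h).2
  -- cut parity: `∑_{v ∈ A} deg_F(v)` is odd
  have hZbeven : IsEvenEdgeSet Zb := hZb.isEvenEdgeSet fun C hC => h𝒞 C hC.1
  have hsum_q₂ : Odd (∑ v ∈ A, edgeDeg (walkEdges q₂) v) := by
    rw [← Finset.add_sum_erase A _ hu₁]
    refine Odd.add_even ((odd_edgeDeg_walkEdges_iff hq₂path huv u₁).2 (Or.inl rfl)) ?_
    refine even_finsetSum _ fun v hv => ?_
    rw [Finset.mem_erase] at hv
    rw [← Nat.not_odd_iff_even, odd_edgeDeg_walkEdges_iff hq₂path huv]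
    rintro (rfl | rfl)
    · exact hv.1 rfl
    · exact hv₁ hv.2
  have hsum_F : Odd (∑ v ∈ A, edgeDeg F v) := by
    have h := even_sum_edgeDeg_symmDiff_add (walkEdges q₂) Zb A
    have hZbsum : Even (∑ v ∈ A, edgeDeg Zb v) := even_finsetSum _ fun v _ => hZbeven v
    rw [← hF] at h
    rcases Nat.even_or_odd (∑ v ∈ A, edgeDeg F v) with hev | hodd
    · exfalso
      have := (Nat.even_add.1 ((Nat.even_add.1 h).2 hZbsum))
      exact (Nat.not_even_iff_odd.2 hsum_q₂) (this.1 hev)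
    · exact hodd
  have hcross : Odd #(F.filter (Crosses A)) := by
    have h := even_card_filter_crosses_add_sum_edgeDeg F hFdiag A
    rcases Nat.even_or_odd #(F.filter (Crosses A)) with hev | hodd
    · exact absurd ((Nat.even_add.1 h).1 hev) (Nat.not_even_iff_odd.2 hsum_F)
    · exact hodd
  -- hence `F` contains a crossing edge inside `V`, i.e. an edge of `E₂`, which comes from `Za`
  obtain ⟨f, hf⟩ : (F.filter (Crosses A)).Nonempty := Finset.card_pos.1 hcross.pos
  rw [Finset.mem_filter] at hf
  have hfE : f ∈ G.edgeSet := by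
    have := hf.1
    rw [hF, mem_symmDiff] at this
    rcases this with ⟨h, -⟩ | ⟨h, -⟩
    · exact mem_edgeSet_of_mem_walkEdges q₂ h
    · exact (hZbE f h).1
  have hfE₂ : f ∈ E₂ := ((hE f).2 ⟨hfE, hFV f hf.1, hf.2⟩).resolve_left (hFE₁ f hf.1)
  -- `F = E(q₁) ∆ Za`
  have hF' : F = symmDiff (walkEdges q₁) Za := by
    have hZb : Zb = symmDiff Za (symmDiff (walkEdges q₁) (walkEdges q₂)) := by
      rw [hZeq, symmDiff_symmDiff_cancel_left]
    rw [hF, hZb, symmDiff_left_comm, symmDiff_comm (walkEdges q₁) (walkEdges q₂),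
      symmDiff_symmDiff_cancel_left, symmDiff_comm]
  have hfZa : f ∈ Za := by
    have := hf.1
    rw [hF', mem_symmDiff, hE₁q₁, Finset.mem_singleton] at this
    rcases this with ⟨h, -⟩ | ⟨h, -⟩
    · exact absurd (h ▸ hfE₂) (Finset.disjoint_left.1 h₁₂ he₁)
    · exact h
  obtain ⟨C, ⟨hC, hP⟩, hfC⟩ := hZa.exists_mem hfZa
  exact hcon C hC hP f hfC hfE₂

end Literature.Combinatorics.SimpleGraph.CycleSpace
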